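import Literature.MathematicalPhysics.QuantumFieldTheory.ConformalBootstrap3D.SigmaEpsilonSystem
import Mathlib.Tactic.Linarith
import Mathlib.Tactic.Ring
import Mathlib.Tactic.Positivity
import HarnessLib

/-!
# Pivots of the Casimir recursion for 3D conformal blocks are positive on the descendant range

Hogervorst–Rychkov, *Radial coordinates for conformal blocks*, Phys. Rev. D 87 (2013) 106004,
§3: the `z`-series of the block of a spin-`ℓ` primary of dimension `Δ` runs over descendants of
dimension `Δ + n` and spin `j = ℓ+n, ℓ+n-2, …, max(ℓ-n, (ℓ+n) mod 2)` (their eq. (3.5), "eq:j"),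
and the Casimir equation becomes the triangular recursion
`(C_{Δ+n,j} - C_{Δ,ℓ}) A_{n,j} = γ⁺ A_{n-1,j-1} + γ⁻ A_{n-1,j+1}` with pivot
`C_{Δ+n,j} - C_{Δ,ℓ} = 2nΔ + n(n-d) + j(j+d-2) - ℓ(ℓ+d-2)` (§3 and §4, text after eq. (4.7)).
The printed assertion (§3, one sentence after the recursion): "One can check that
`C_{Δ+n,j} - C_{Δ,ℓ} > 0` if `Δ` satisfies unitarity bounds and `j` is in the range eq:j." Here
this is PROVED at `d = 3` (`casimirPivot3D_pos`), in the sharp form: strictly above the 3D unitarity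
bound (`unitarityBound3D`: `1/2` for `ℓ = 0`, `ℓ+1` for `ℓ ≥ 1`) every pivot with `n ≥ 1`,
`|j - ℓ| ≤ n`, `j ≡ ℓ + n (mod 2)` is positive. (At the bound itself the pivot `(n,j) = (1, ℓ-1)`,
resp. `(2,0)` for `ℓ = 0`, vanishes — the conserved-current / free-scalar null states; not needed.)

Consequences for the typed σ–ε system (`SigmaEpsilonSystem.lean`):
* `accidentalDegeneracy3D_unreachable`: above the bound, every witness `(n, j)` of
  `accidentalDegeneracy3D Δ ℓ` (which quantifies over the LARGER range `0 ≤ j ≤ ℓ + n`) has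
  `j + n < ℓ`, i.e. lies outside the Hogervorst–Rychkov descendant range — the accidental
  degeneracies are artefacts of the permissive double-power-series ansatz, never met by an
  evaluator built on the recursion (pub-ising3d REFEREE F20/F23; checked there by enumeration for
  `ℓ ≤ 10`, here for all `ℓ`).
* `not_accidentalDegeneracy3D_of_le_two`, `isRegularPoint3D_of_le_two`: for `ℓ ≤ 2` there is no
  accidental degeneracy above the bound (the docstring claim "empty for `ℓ ≤ 2`" of
  `accidentalDegeneracy3D`, now a theorem), so there `IsConformalBlock3D` is the generic predicate.

Everything is elementary real arithmetic (case analysis `j ≥ ℓ` / `j = ℓ - k`); no new definition of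
content beyond the displayed pivot. [cite: HogervorstRychkov2013, §3 eq. (3.5) and the sentence
after the recursion (3.9); §4 after eq. (4.7)]
-/

namespace Literature.MathematicalPhysics.QuantumFieldTheory.ConformalBootstrap3D

/-- The pivot of the level-`n`, spin-`j` step of the Casimir recursion for the 3D block of a
spin-`ℓ`, dimension-`Δ` primary: `C_{Δ+n,j} - C_{Δ,ℓ} = 2nΔ + n(n-3) + j(j+1) - ℓ(ℓ+1)`
(Hogervorst–Rychkov 2013, §4, the displayed factor with `d = 3`; it is the expression inside
`accidentalDegeneracy3D`). [cite: HogervorstRychkov2013, §4 after eq. (4.7)] -/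
def casimirPivot3D (Δ : ℝ) (ℓ n j : ℕ) : ℝ :=
  2 * (n : ℝ) * Δ + (n : ℝ) * ((n : ℝ) - 3) + (j : ℝ) * ((j : ℝ) + 1) - (ℓ : ℝ) * ((ℓ : ℝ) + 1)

/-- `casimirPivot3D` is twice the difference of the Casimir eigenvalues `casimirEigenvalue3D`
of `(Δ+n, j)` and `(Δ, ℓ)`. [cite: HogervorstRychkov2013, §4 after eq. (4.7)] -/
theorem casimirPivot3D_eq (Δ : ℝ) (ℓ n j : ℕ) :
    casimirPivot3D Δ ℓ n j =
      2 * (casimirEigenvalue3D (Δ + n) j - casimirEigenvalue3D Δ ℓ) := by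
  unfold casimirPivot3D casimirEigenvalue3D
  ring

/-- `accidentalDegeneracy3D` is literally the vanishing of some `casimirPivot3D` with `n ≥ 1`,
`j ≤ ℓ + n`, `j ≡ ℓ + n (mod 2)`. [cite: HogervorstRychkov2013, §3–4] -/
theorem accidentalDegeneracy3D_iff (Δ : ℝ) (ℓ : ℕ) :
    accidentalDegeneracy3D Δ ℓ ↔
      ∃ n j : ℕ, 1 ≤ n ∧ j ≤ ℓ + n ∧ (j + ℓ + n) % 2 = 0 ∧ casimirPivot3D Δ ℓ n j = 0 :=
  Iff.rfl

/-- Above the unitarity bound one has in particular `Δ > 1/2`. [folklore] -/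
theorem one_half_lt_of_unitarityBound3D_lt {Δ : ℝ} {ℓ : ℕ} (h : unitarityBound3D ℓ < Δ) :
    1 / 2 < Δ := by
  unfold unitarityBound3D at h
  split_ifs at h with h0
  · exact h
  · have : (1 : ℝ) ≤ (ℓ : ℝ) := by exact_mod_cast Nat.one_le_iff_ne_zero.mpr h0
    linarith

/-- For `ℓ ≥ 1`, above the unitarity bound means `Δ > ℓ + 1`. [folklore] -/
theorem cast_add_one_lt_of_unitarityBound3D_lt {Δ : ℝ} {ℓ : ℕ} (hℓ : 1 ≤ ℓ)
    (h : unitarityBound3D ℓ < Δ) : (ℓ : ℝ) + 1 < Δ := by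
  unfold unitarityBound3D at h
  have h0 : ℓ ≠ 0 := by omega
  rw [if_neg h0] at h
  exact h

/-- **Hogervorst–Rychkov pivot positivity (d = 3).** Strictly above the 3D unitarity bound, every
pivot of the Casimir recursion on the descendant range `n ≥ 1`, `ℓ - n ≤ j ≤ ℓ + n`,
`j ≡ ℓ + n (mod 2)` is positive: `2nΔ + n(n-3) + j(j+1) - ℓ(ℓ+1) > 0`. ("One can check that
`C_{Δ+n,j} - C_{Δ,l} > 0` if `Δ` satisfies unitarity bounds and `j` is in the range (3.5)" —
here with the strict bound, which is what makes the `(1, ℓ-1)` pivot positive.) Proof: if `j ≥ ℓ`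
then `j(j+1) ≥ ℓ(ℓ+1)` and `n(2Δ+n-3) > 0` for `n ≥ 2`, while `n = 1` forces `j = ℓ+1`; if
`j = ℓ - k` with `1 ≤ k ≤ n` then the pivot exceeds `2ℓ(n-k) + n(n-1) + k(k-1) ≥ 0`.
[cite: HogervorstRychkov2013, §3 after eq. (3.9)] -/
theorem casimirPivot3D_pos {Δ : ℝ} {ℓ n j : ℕ} (hΔ : unitarityBound3D ℓ < Δ) (hn : 1 ≤ n)
    (hjl : ℓ ≤ j + n) (hju : j ≤ ℓ + n) (hpar : (j + ℓ + n) % 2 = 0) :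
    0 < casimirPivot3D Δ ℓ n j := by
  have hhalf : 1 / 2 < Δ := one_half_lt_of_unitarityBound3D_lt hΔ
  unfold casimirPivot3D
  have hn' : (1 : ℝ) ≤ (n : ℝ) := by exact_mod_cast hn
  rcases le_or_gt ℓ j with hle | hlt
  · -- case `j ≥ ℓ`
    have hjl' : (ℓ : ℝ) ≤ (j : ℝ) := by exact_mod_cast hle
    have hsq : (ℓ : ℝ) * ((ℓ : ℝ) + 1) ≤ (j : ℝ) * ((j : ℝ) + 1) := by nlinarith
    rcases Nat.lt_or_ge n 2 with hn2 | hn2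
    · -- `n = 1`: parity forces `j = ℓ + 1`
      have hn1 : n = 1 := by omega
      subst hn1
      have hj : j = ℓ + 1 := by omega
      subst hj
      push_cast
      nlinarith
    · have hn2' : (2 : ℝ) ≤ (n : ℝ) := by exact_mod_cast hn2
      nlinarith
  · -- case `j < ℓ`: write `j = ℓ - k`, `1 ≤ k ≤ n`, and here `ℓ ≥ 1`
    have hℓ1 : 1 ≤ ℓ := by omega
    have hΔ' : (ℓ : ℝ) + 1 < Δ := cast_add_one_lt_of_unitarityBound3D_lt hℓ1 hΔ
    obtain ⟨k, hk⟩ : ∃ k : ℕ, ℓ = j + k := ⟨ℓ - j, by omega⟩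
    have hk1 : 1 ≤ k := by omega
    have hkn : k ≤ n := by omega
    subst hk
    push_cast at hΔ' ⊢
    have hk1' : (1 : ℝ) ≤ (k : ℝ) := by exact_mod_cast hk1
    have hkn' : (k : ℝ) ≤ (n : ℝ) := by exact_mod_cast hkn
    have hj0 : (0 : ℝ) ≤ (j : ℝ) := by exact_mod_cast Nat.zero_le j
    -- pivot = 2n(Δ - (j+k+1)) + 2j(n-k) + n(n-1) + k(2n-k-1), each term ≥ 0, the first > 0
    have key : 2 * (n : ℝ) * Δ + (n : ℝ) * ((n : ℝ) - 3) + (j : ℝ) * ((j : ℝ) + 1)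
        - ((j : ℝ) + (k : ℝ)) * ((j : ℝ) + (k : ℝ) + 1)
        = 2 * (n : ℝ) * (Δ - ((j : ℝ) + (k : ℝ) + 1)) + 2 * (j : ℝ) * ((n : ℝ) - (k : ℝ))
          + (n : ℝ) * ((n : ℝ) - 1) + (k : ℝ) * (2 * (n : ℝ) - (k : ℝ) - 1) := by ring
    rw [key]
    have h1 : 0 < 2 * (n : ℝ) * (Δ - ((j : ℝ) + (k : ℝ) + 1)) := by
      have : (0 : ℝ) < Δ - ((j : ℝ) + (k : ℝ) + 1) := by linarith
      positivity
    have h2 : 0 ≤ 2 * (j : ℝ) * ((n : ℝ) - (k : ℝ)) := by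
      have : (0 : ℝ) ≤ (n : ℝ) - (k : ℝ) := by linarith
      positivity
    have h3 : 0 ≤ (n : ℝ) * ((n : ℝ) - 1) := by
      have : (0 : ℝ) ≤ (n : ℝ) - 1 := by linarith
      positivity
    have h4 : 0 ≤ (k : ℝ) * (2 * (n : ℝ) - (k : ℝ) - 1) := by
      have : (0 : ℝ) ≤ 2 * (n : ℝ) - (k : ℝ) - 1 := by linarith
      positivity
    linarith

/-- Above the unitarity bound, every accidental degeneracy is an **unreachable seed**: its
witness `(n, j)` has `j + n < ℓ`, i.e. spin `j` below the Hogervorst–Rychkov descendant range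
`j ≥ ℓ - n`. (pub-ising3d REFEREE F23, there checked by enumeration for `ℓ ≤ 10`.)
[cite: HogervorstRychkov2013, §3 eq. (3.5)] -/
theorem accidentalDegeneracy3D_unreachable {Δ : ℝ} {ℓ : ℕ} (hΔ : unitarityBound3D ℓ < Δ)
    (h : accidentalDegeneracy3D Δ ℓ) :
    ∃ n j : ℕ, 1 ≤ n ∧ j + n < ℓ ∧ (j + ℓ + n) % 2 = 0 ∧ casimirPivot3D Δ ℓ n j = 0 := by
  obtain ⟨n, j, hn, hju, hpar, hz⟩ := h
  refine ⟨n, j, hn, ?_, hpar, hz⟩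
  by_contra hge
  have hjl : ℓ ≤ j + n := by omega
  have := casimirPivot3D_pos hΔ hn hjl hju hpar
  unfold casimirPivot3D at this
  linarith

/-- For `ℓ ≤ 2` there is no accidental degeneracy above the unitarity bound (an unreachable seed
needs `j + n < ℓ` with `n ≥ 1` and `j ≡ ℓ + n (mod 2)`, impossible for `ℓ ≤ 2`): the docstring
claim "empty for `ℓ ≤ 2`" of `accidentalDegeneracy3D`. [cite: HogervorstRychkov2013, §3 eq. (3.5)] -/
theorem not_accidentalDegeneracy3D_of_le_two {Δ : ℝ} {ℓ : ℕ} (hℓ : ℓ ≤ 2)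
    (hΔ : unitarityBound3D ℓ < Δ) : ¬ accidentalDegeneracy3D Δ ℓ := by
  intro h
  obtain ⟨n, j, hn, hlt, hpar, _⟩ := accidentalDegeneracy3D_unreachable hΔ h
  omega

/-- Hence for `ℓ ≤ 2` every point strictly above the unitarity bound is regular
(`IsRegularPoint3D`), so `IsConformalBlock3D` is the generic predicate there — this covers the
scalars and the spin-2 sector of the σ–ε system. [cite: HogervorstRychkov2013, §3 eq. (3.5)] -/
theorem isRegularPoint3D_of_le_two {Δ : ℝ} {ℓ : ℕ} (hℓ : ℓ ≤ 2) (hΔ : unitarityBound3D ℓ < Δ) :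
    IsRegularPoint3D Δ ℓ :=
  ⟨ne_of_gt hΔ, not_accidentalDegeneracy3D_of_le_two hℓ hΔ⟩

/-- At a regular point the genuine block predicate reduces to the generic one. Elementary
unfolding of `IsConformalBlock3D`. [folklore] -/
theorem isConformalBlock3D_iff_above_of_isRegularPoint3D {Δ₁₂ Δ₃₄ Δ : ℝ} {ℓ : ℕ}
    {g : ℝ → ℝ → ℝ} (h : IsRegularPoint3D Δ ℓ) :
    IsConformalBlock3D Δ₁₂ Δ₃₄ Δ ℓ g ↔ IsConformalBlock3DAbove Δ₁₂ Δ₃₄ Δ ℓ g := by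
  unfold IsConformalBlock3D
  constructor
  · rintro (⟨_, hA⟩ | ⟨hnr, _⟩)
    · exact hA
    · exact (hnr h).elim
  · intro hA
    exact Or.inl ⟨h, hA⟩

end Literature.MathematicalPhysics.QuantumFieldTheory.ConformalBootstrap3D
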